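import Mathlib
import HarnessLib
import Summits.NavierStokesRegularity.NavierStokesRegularity.Theorems.UnthreadedDoorCellFluxWindowDecayDefs
import Summits.NavierStokesRegularity.NavierStokesRegularity.Theorems.UnthreadedDoorCellFluxWindowDecayTools
import Summits.NavierStokesRegularity.NavierStokesRegularity.Theorems.UnthreadedDoorNetFluxWindowDecayOffNull

/-!
# Route `UnthreadedDoor`, crux `PoloidalLiouville` (stmt-NavierStokesRegularity-1222), WALL W1 — crux idea «cell-flux», Σ-3′:
# window decay of the cumulative CLUSTER flux off a closed null set of times (AE-4′ re-run)

★ `clusterFluxWindowDecayOffNullInt_of : ClusterFluxOneSidedLawOffNull → ClusterFluxLeVorticity → ClusterFluxNearCentreLinked →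
ClusterFluxTimeLipschitz → HalfLineOUDecayOffNullClosed → ClusterFluxWindowDecayOffNullInt` — the sketch's Σ-3′ stub
`stub_clusterFluxWindowDecayOffNullInt` (`Cruxes/PoloidalLiouville/CellFluxSketch.lean` v1.2.12, custodian ns-idea-14) with ONE antecedent added,
Σ-0e `ClusterFluxTimeLipschitz` (typed in `UnthreadedDoorCellFluxWindowDecayDefs`): the cluster analogue of AE-3 `CumulativeFluxLipschitz`, the fourth
input of AE-4′ that the v1.2.12 antecedents do not carry (ns-qj-p1 g8 typing note, bus 2026-08-29T14:31Z).  All five antecedents are the Theorems-side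
twins (`UnthreadedDoorCellFluxDefs` p692073 / `UnthreadedDoorCellFluxWindowDecayDefs`), bodies verbatim from the sketch, so the sketch closes its
(re-typed) stub by the bare term.

Proof = ARM A's AE-4′ `netFluxWindowDecayOffNull` (p687897-era file `UnthreadedDoorNetFluxWindowDecayOffNull`) run with the window functional
`w t r := clusterFlux (T t) r (𝒞 t r)`: growth `0 ≤ w ≤ N₀πC₁ r/(−t)` EVERYWHERE (`CellFlux.clusterFlux_window_growth`: Σ-0a on the counted points +
density + the rule's joint continuity), the law from Σ-2 applied to the rule, near-centre control from Σ-0b′ (dense count from `cellPred N₀ D`,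
`CellFlux.slab_subset_closure_counted`), the `s`-Lipschitz bound of the self-similar cumulative flux from Σ-0e (fixed upper limit) + the density
bound (moving upper limit), the viscosity inequality from the generic `NetFlux.viscosity_inequality_window_at`, and the comparison AE-2′ taken as the
hypothesis; the integrability conjunct is `NetFlux.window_integrableOn_Ioc`.  HONEST: bookkeeping under crux 1222; Σ-2, Σ-0b′ (its Σ-0bR₂ half), Σ-0e
are OPEN; W1 movement 0; NS regularity NOT proved.  `--supports stmt-NavierStokesRegularity-1222 --as helper`.  [folklore]
-/

-- the summit and its single sub-problem share the name (CONVENTIONS §1)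
set_option linter.dupNamespace false

noncomputable section

open Set Function Filter Topology MeasureTheory intervalIntegral
open scoped Topology

namespace Summit.NavierStokesRegularity.NavierStokesRegularity.Theorems.PoloidalLiouville.CellFlux

open Summit.NavierStokesRegularity.NavierStokesRegularity.Theorems.PoloidalLiouville.NetFlux
  (E3 abs_exp_neg_sub_le abs_exp_neg_half_sub_le continuousOn_window_primitive window_primitive_le window_intervalIntegrable
   window_integrableOn_Ioc viscosity_inequality_window_at setIntegral_Ioo_eq_intervalIntegral)
open Literature.Analysis Literature.Analysis.FluidPDE

set_option maxHeartbeats 800000 in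
/-- ★ **Σ-3′ re-run: window decay of the cumulative cluster flux off a closed null set of times**, from the one-sided law Σ-2, the growth Σ-0a,
the near-centre control Σ-0b′, the time-Lipschitz control Σ-0e and the off-null OU comparison AE-2′ (all as hypotheses, Theorems-side twins). [folklore] -/
theorem clusterFluxWindowDecayOffNullInt_of (h₁ : ClusterFluxOneSidedLawOffNull) (h₂ : ClusterFluxLeVorticity)
    (h₃ : ClusterFluxNearCentreLinked) (hE : ClusterFluxTimeLipschitz) (h₄ : HalfLineOUDecayOffNullClosed) :
    ClusterFluxWindowDecayOffNullInt := by
  intro N₀ D hD hD0 C hC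
  obtain ⟨lam, hlam, A, hOU⟩ := h₄ C hC
  refine ⟨lam, hlam, A * (Real.pi / 2), ?_⟩
  intro v x₀ T P C₁ t₀ ht₀ hv hT hP hvC hωC hhead hlink hlaw hcell 𝒞 h𝒞 t₁ t R ht₁ ht₁t ht hR
  -- the window functional and its constant
  set K : ℝ := (N₀ : ℝ) * Real.pi * C₁ with hK
  -- `0 ≤ C₁`
  have ht₁mem : t₁ ∈ Ioo t₀ 0 := ⟨ht₁, lt_of_le_of_lt ht₁t ht⟩
  have hC₁ : 0 ≤ C₁ := by
    have h0 : (0:ℝ) ≤ C₁ / (-t₁) := le_trans (norm_nonneg _) (hωC t₁ ht₁mem x₀)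
    have hnt : 0 < -t₁ := by linarith [ht₁mem.2]
    by_contra hneg
    push Not at hneg
    have : C₁ / (-t₁) < 0 := div_neg_of_neg_of_pos hneg hnt
    linarith
  have hK0 : 0 ≤ K := by rw [hK]; positivity
  -- (1) the a-priori bound on the cluster-flux density (Σ-0a + density + continuity of the rule)
  have hbd : ∀ t' ∈ Ioo t₀ 0, ∀ r, 0 < r →
      0 ≤ clusterFlux (T t') r (𝒞 t' r) ∧ clusterFlux (T t') r (𝒞 t' r) ≤ K * r / (-t') :=
    clusterFlux_window_growth h₂ hD0 hv hT hωC hlink hcell h𝒞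
  -- the counted points are dense in the slab
  have hdense := slab_subset_closure_counted (v := v) (x₀ := x₀) (T := T) hD0 hcell
  have hcount : ∀ S : Set (ℝ × ℝ), S ⊆ Ioo t₀ 0 ×ˢ Ioi (0 : ℝ) →
      S ⊆ closure {p : ℝ × ℝ | p.1 ∈ Ioo t₀ 0 ∧ 0 < p.2 ∧
        (cellSet (T p.1) x₀ p.2).Finite ∧ (cellSet (T p.1) x₀ p.2).ncard ≤ N₀} := fun S hS =>
    (hS.trans hdense).trans (closure_mono fun q hq => ⟨hq.1, hq.2.1, hq.2.2.2⟩)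
  -- (L) for these data and this rule (Σ-2)
  obtain ⟨ℓp, ℓm, hcont, hℓp, hℓm, hlawL⟩ :=
    h₁ N₀ D hD v x₀ T P (fun s => C / Real.sqrt (-s)) t₀ hv hT hP hvC hhead hlink hlaw hcell 𝒞 h𝒞
  have hcont' : ContinuousOn (fun p : ℝ × ℝ => clusterFlux (T p.1) p.2 (𝒞 p.1 p.2)) (Ioo t₀ 0 ×ˢ Ioi 0) := hcont
  -- (NC) for these data and this rule (Σ-0b′)
  have hnc : ∀ t₁' t₂' : ℝ, t₀ < t₁' → t₁' ≤ t₂' → t₂' < 0 → ∃ κ : ℝ, 0 ≤ κ ∧ ∀ a₀ : ℝ, 0 < a₀ → a₀ ≤ 1 →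
      (∀ t' ∈ Icc t₁' t₂', (∀ a ∈ Ioo 0 a₀, clusterFlux (T t') a (𝒞 t' a) ≤ κ * a ^ 2) ∧
        LipschitzOnWith (Real.toNNReal (κ * a₀)) (fun r => clusterFlux (T t') r (𝒞 t' r)) (Ioo 0 a₀)) ∧
      (∀ t' ∈ Icc t₁' t₂', ∀ t'' ∈ Icc t₁' t₂', ∀ a ∈ Ioo 0 a₀,
        |clusterFlux (T t') a (𝒞 t' a) - clusterFlux (T t'') a (𝒞 t'' a)| ≤ κ * a ^ 2 * |t' - t''|) :=
    fun t₁' t₂' h1 h2 h3 => h₃ v x₀ T P (fun s => C / Real.sqrt (-s)) N₀ t₀ t₁' t₂' h1 h2 h3 hv hT hlink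
      (hcount _ (prod_mono (Icc_subset_Ioo h1 h3) Ioo_subset_Ioi_self)) 𝒞 h𝒞
  -- (2) the self-similar cumulative flux `U`
  set s₁ : ℝ := -Real.log (-t₁) with hs₁
  have hnt₁ : 0 < -t₁ := by linarith [ht₁mem.2]
  have hτs₁ : -Real.exp (-s₁) = t₁ := by rw [hs₁, neg_neg, Real.exp_log hnt₁, neg_neg]
  have hτ : ∀ s, s₁ ≤ s → -Real.exp (-s) ∈ Ioo t₀ 0 := fun s hs => by
    refine ⟨?_, neg_neg_of_pos (Real.exp_pos _)⟩
    have h1 : Real.exp (-s) ≤ Real.exp (-s₁) := Real.exp_le_exp.2 (by linarith)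
    linarith [hτs₁]
  obtain ⟨U, hU⟩ : ∃ U : ℝ → ℝ → ℝ, ∀ s ρ,
      U s ρ = ∫ r in (0:ℝ)..(ρ * Real.exp (-s / 2)), clusterFlux (T (-Real.exp (-s))) r (𝒞 (-Real.exp (-s)) r) :=
    ⟨fun s ρ => ∫ r in (0:ℝ)..(ρ * Real.exp (-s / 2)), clusterFlux (T (-Real.exp (-s))) r (𝒞 (-Real.exp (-s)) r),
      fun _ _ => rfl⟩
  have hW := continuousOn_window_primitive (w := fun t' r => clusterFlux (T t') r (𝒞 t' r)) (t₀ := t₀) (K := K)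
    hcont' hbd
  have hUcont : ContinuousOn (uncurry U) (Ici s₁ ×ˢ Ici 0) := by
    have hmap : Continuous (fun q : ℝ × ℝ => ((-Real.exp (-q.1), q.2 * Real.exp (-q.1 / 2)) : ℝ × ℝ)) := by
      fun_prop
    have hmaps : MapsTo (fun q : ℝ × ℝ => ((-Real.exp (-q.1), q.2 * Real.exp (-q.1 / 2)) : ℝ × ℝ))
        (Ici s₁ ×ˢ Ici 0) (Ioo t₀ 0 ×ˢ Ici 0) :=
      fun q hq => ⟨hτ q.1 hq.1, mul_nonneg hq.2 (Real.exp_pos _).le⟩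
    have hcomp := hW.comp hmap.continuousOn hmaps
    have heq : uncurry U = (fun p : ℝ × ℝ => ∫ r in (0:ℝ)..p.2, clusterFlux (T p.1) r (𝒞 p.1 r)) ∘
        (fun q : ℝ × ℝ => ((-Real.exp (-q.1), q.2 * Real.exp (-q.1 / 2)) : ℝ × ℝ)) := by
      funext q
      simp only [Function.comp_apply, Function.uncurry_def]
      rw [hU]
    rw [heq]
    exact hcomp
  have hU0 : ∀ s, s₁ ≤ s → U s 0 ≤ 0 := fun s _ => by rw [hU]; simp
  have hUgr : ∀ s, s₁ ≤ s → ∀ ρ, 0 ≤ ρ → U s ρ ≤ K / 2 * (1 + ρ) ^ 3 := by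
    intro s hs ρ hρ
    rw [hU]
    have hb := window_primitive_le (w := fun t' r => clusterFlux (T t') r (𝒞 t' r)) (t₀ := t₀) (K := K)
      hcont' hbd (hτ s hs) (R := ρ * Real.exp (-s / 2)) (mul_nonneg hρ (Real.exp_pos _).le)
    have he : Real.exp (-s / 2) ^ 2 = Real.exp (-s) := by rw [sq, ← Real.exp_add]; ring_nf
    have hval : K / -(-Real.exp (-s)) * (ρ * Real.exp (-s / 2)) ^ 2 / 2 = K / 2 * ρ ^ 2 := by
      rw [neg_neg, mul_pow, he]; field_simp
    have hρ3 : ρ ^ 2 ≤ (1 + ρ) ^ 3 := by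
      have h3 : 0 ≤ ρ ^ 3 := pow_nonneg hρ 3
      nlinarith [sq_nonneg ρ]
    calc ∫ r in (0:ℝ)..(ρ * Real.exp (-s / 2)), clusterFlux (T (-Real.exp (-s))) r (𝒞 (-Real.exp (-s)) r)
        ≤ K / 2 * ρ ^ 2 := hval ▸ hb
      _ ≤ K / 2 * (1 + ρ) ^ 3 := mul_le_mul_of_nonneg_left hρ3 (by positivity)
  -- the exceptional set of self-similar times `D' = {s | −e^{−s} ∈ D}`: closed and null
  set D' : Set ℝ := {σ : ℝ | -Real.exp (-σ) ∈ D} with hD'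
  have hD'c : IsClosed D' := hD.preimage (by fun_prop)
  have hD'0 : volume D' = 0 := by
    have hsub : D' ⊆ (fun t : ℝ => -Real.log (-t)) '' (D ∩ Iio 0) := by
      intro σ hσ
      refine ⟨-Real.exp (-σ), ⟨hσ, neg_neg_of_pos (Real.exp_pos _)⟩, ?_⟩
      show -Real.log (-(-Real.exp (-σ))) = σ
      rw [neg_neg, Real.log_exp, neg_neg]
    have hdiff : DifferentiableOn ℝ (fun t : ℝ => -Real.log (-t)) (D ∩ Iio 0) := by
      intro t ht
      have h0 : -t ≠ 0 := by have := ht.2; rw [mem_Iio] at this; linarith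
      exact (((Real.hasDerivAt_log h0).comp t (hasDerivAt_neg t)).neg).differentiableAt.differentiableWithinAt
    have h0 : volume (D ∩ Iio 0) = 0 := measure_mono_null inter_subset_left hD0
    exact measure_mono_null hsub
      (MeasureTheory.addHaar_image_eq_zero_of_differentiableOn_of_addHaar_eq_zero volume hdiff h0)
  -- `U` is Lipschitz in `s` on `[a,b] × [0,Rρ]`, `s₁ < a` (Σ-0e at the fixed upper limit + the density bound at the moving one)
  have hULip : ∀ a b Rρ : ℝ, s₁ < a → a < b → 0 < Rρ →
      ∃ L : NNReal, ∀ ρ ∈ Icc 0 Rρ, LipschitzOnWith L (fun s => U s ρ) (Icc a b) := by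
    intro a b Rρ ha hab hRρ
    -- the physical times of `[a,b]`
    have hτa : t₁ < -Real.exp (-a) := by
      rw [← hτs₁]; have := Real.exp_lt_exp.2 (neg_lt_neg ha); linarith
    have hτab : -Real.exp (-a) < -Real.exp (-b) := by
      have := Real.exp_lt_exp.2 (neg_lt_neg hab); linarith
    have hτb0 : -Real.exp (-b) < 0 := neg_neg_of_pos (Real.exp_pos _)
    have hτmem : ∀ s ∈ Icc a b, -Real.exp (-s) ∈ Icc (-Real.exp (-a)) (-Real.exp (-b)) := by
      intro s hs
      constructor
      · have := Real.exp_le_exp.2 (neg_le_neg hs.1); linarith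
      · have := Real.exp_le_exp.2 (neg_le_neg hs.2); linarith
    set R' : ℝ := Rρ * Real.exp (-a / 2) with hR'
    have hR'0 : 0 < R' := by positivity
    have hρ' : ∀ s ∈ Icc a b, ∀ ρ ∈ Icc (0:ℝ) Rρ, ρ * Real.exp (-s / 2) ∈ Icc 0 R' := by
      intro s hs ρ hρ
      refine ⟨mul_nonneg hρ.1 (Real.exp_pos _).le, ?_⟩
      have h1 : Real.exp (-s / 2) ≤ Real.exp (-a / 2) := Real.exp_le_exp.2 (by linarith [hs.1])
      calc ρ * Real.exp (-s / 2) ≤ Rρ * Real.exp (-s / 2) := mul_le_mul_of_nonneg_right hρ.2 (Real.exp_pos _).le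
        _ ≤ Rρ * Real.exp (-a / 2) := mul_le_mul_of_nonneg_left h1 hRρ.le
    -- Σ-0e on `[−e^{−a}, −e^{−b}] × (0, R' + 1)`
    obtain ⟨L₁, hL₁0, hL₁⟩ := hE v x₀ T P (fun s => C / Real.sqrt (-s)) N₀ t₀ (-Real.exp (-a)) (-Real.exp (-b))
      (ht₁.trans hτa) hτab.le hτb0 hv hT hlink
      (hcount _ (prod_mono (Icc_subset_Ioo (ht₁.trans hτa) hτb0) Subset.rfl)) 𝒞 h𝒞 (R' + 1) (by linarith)
    -- sup of the density on `(0, R']` at times `≥ −e^{−a}`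
    set M₂ : ℝ := K * R' / Real.exp (-b) with hM₂
    have hM₂0 : 0 ≤ M₂ := by positivity
    have hdens : ∀ s ∈ Icc a b, ∀ r, 0 < r → r ≤ R' →
        |clusterFlux (T (-Real.exp (-s))) r (𝒞 (-Real.exp (-s)) r)| ≤ M₂ := by
      intro s hs r hr hrR
      have hmem : -Real.exp (-s) ∈ Ioo t₀ 0 := hτ s (ha.le.trans hs.1)
      obtain ⟨h0, h1⟩ := hbd _ hmem r hr
      rw [abs_of_nonneg h0, neg_neg] at *
      have h2 : Real.exp (-b) ≤ Real.exp (-s) := Real.exp_le_exp.2 (by linarith [hs.2])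
      calc clusterFlux (T (-Real.exp (-s))) r (𝒞 (-Real.exp (-s)) r) ≤ K * r / Real.exp (-s) := h1
        _ ≤ K * R' / Real.exp (-s) := by gcongr
        _ ≤ K * R' / Real.exp (-b) := by
            apply div_le_div_of_nonneg_left (by positivity) (Real.exp_pos _) h2
    refine ⟨Real.toNNReal (L₁ * R' * Real.exp (-a) + M₂ * Rρ * Real.exp (-a / 2)),
      fun ρ hρ => LipschitzOnWith.of_dist_le_mul fun s hs s' hs' => ?_⟩
    rw [Real.dist_eq, Real.dist_eq, Real.coe_toNNReal _ (by positivity)]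
    -- the two upper limits
    set P₁ : ℝ := ρ * Real.exp (-s / 2) with hP₁
    set P' : ℝ := ρ * Real.exp (-s' / 2) with hP'
    have hP0 : 0 ≤ P₁ := mul_nonneg hρ.1 (Real.exp_pos _).le
    have hP'0 : 0 ≤ P' := mul_nonneg hρ.1 (Real.exp_pos _).le
    have hPR : P₁ ≤ R' := (hρ' s hs ρ hρ).2
    have hP'R : P' ≤ R' := (hρ' s' hs' ρ hρ).2
    -- shorthand for the two slices
    set F : ℝ → ℝ := fun r => clusterFlux (T (-Real.exp (-s))) r (𝒞 (-Real.exp (-s)) r) with hF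
    set F' : ℝ → ℝ := fun r => clusterFlux (T (-Real.exp (-s'))) r (𝒞 (-Real.exp (-s')) r) with hF'
    have hUs : U s ρ = ∫ r in (0:ℝ)..P₁, F r := by rw [hU]
    have hUs' : U s' ρ = ∫ r in (0:ℝ)..P', F' r := by rw [hU]
    have hsplit : U s ρ - U s' ρ
        = ((∫ r in (0:ℝ)..P₁, F r) - ∫ r in (0:ℝ)..P₁, F' r)
          + ((∫ r in (0:ℝ)..P₁, F' r) - ∫ r in (0:ℝ)..P', F' r) := by
      rw [hUs, hUs']; ring
    have hτs : -Real.exp (-s) ∈ Ioo t₀ 0 := hτ s (ha.le.trans hs.1)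
    have hτs' : -Real.exp (-s') ∈ Ioo t₀ 0 := hτ s' (ha.le.trans hs'.1)
    have hiP₁ : IntervalIntegrable F volume 0 P₁ := window_intervalIntegrable hcont' hbd hτs le_rfl hP0
    have hiP : IntervalIntegrable F' volume 0 P₁ := window_intervalIntegrable hcont' hbd hτs' le_rfl hP0
    have hiP' : IntervalIntegrable F' volume 0 P' := window_intervalIntegrable hcont' hbd hτs' le_rfl hP'0
    -- first difference: Σ-0e at the fixed radii `r ∈ (0, P₁]`, `P₁ ≤ R'`
    have hea : |(-Real.exp (-s)) - (-Real.exp (-s'))| ≤ Real.exp (-a) * |s - s'| := by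
      rw [neg_sub_neg, abs_sub_comm]; exact abs_exp_neg_sub_le hs.1 hs'.1
    have h1 : |(∫ r in (0:ℝ)..P₁, F r) - ∫ r in (0:ℝ)..P₁, F' r| ≤ L₁ * R' * Real.exp (-a) * |s - s'| := by
      rw [← intervalIntegral.integral_sub hiP₁ hiP]
      have hb := intervalIntegral.norm_integral_le_of_norm_le_const (a := 0) (b := P₁)
        (C := L₁ * (Real.exp (-a) * |s - s'|)) (f := fun r => F r - F' r) (fun r hr => by
          rw [uIoc_of_le hP0] at hr
          have hr0 : 0 < r := hr.1
          have hrR : r < R' + 1 := by linarith [hr.2]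
          rw [Real.norm_eq_abs, hF, hF']
          calc _ ≤ L₁ * |(-Real.exp (-s)) - (-Real.exp (-s'))| :=
                hL₁ _ (hτmem s hs) _ (hτmem s' hs') r ⟨hr0, hrR⟩
            _ ≤ L₁ * (Real.exp (-a) * |s - s'|) := mul_le_mul_of_nonneg_left hea hL₁0)
      rw [Real.norm_eq_abs, sub_zero, abs_of_nonneg hP0] at hb
      calc _ ≤ L₁ * (Real.exp (-a) * |s - s'|) * P₁ := hb
        _ ≤ L₁ * (Real.exp (-a) * |s - s'|) * R' := mul_le_mul_of_nonneg_left hPR (by positivity)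
        _ = L₁ * R' * Real.exp (-a) * |s - s'| := by ring
    -- second difference: moving upper limit, density bounded by `M₂`
    have hlim : |P₁ - P'| ≤ Rρ * Real.exp (-a / 2) * |s - s'| := by
      rw [hP₁, hP', ← mul_sub, abs_mul, abs_of_nonneg hρ.1]
      calc ρ * |Real.exp (-s / 2) - Real.exp (-s' / 2)| ≤ Rρ * (Real.exp (-a / 2) * |s - s'|) :=
            mul_le_mul hρ.2 (abs_exp_neg_half_sub_le hs.1 hs'.1) (abs_nonneg _) hRρ.le
        _ = Rρ * Real.exp (-a / 2) * |s - s'| := by ring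
    have h2 : |(∫ r in (0:ℝ)..P₁, F' r) - ∫ r in (0:ℝ)..P', F' r| ≤ M₂ * (Rρ * Real.exp (-a / 2) * |s - s'|) := by
      rw [intervalIntegral.integral_interval_sub_left hiP hiP']
      have hb := intervalIntegral.norm_integral_le_of_norm_le_const (a := P') (b := P₁) (C := M₂)
        (f := F') (fun r hr => by
          have hr0 : 0 < r := by
            rcases mem_uIoc.1 hr with h | h
            · exact lt_of_le_of_lt hP'0 h.1
            · exact lt_of_le_of_lt hP0 h.1
          have hrR : r ≤ R' := by
            rcases mem_uIoc.1 hr with h | h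
            · exact h.2.trans hPR
            · exact h.2.trans hP'R
          rw [Real.norm_eq_abs]
          exact hdens s' hs' r hr0 hrR)
      rw [Real.norm_eq_abs] at hb
      calc _ ≤ M₂ * |P₁ - P'| := hb
        _ ≤ M₂ * (Rρ * Real.exp (-a / 2) * |s - s'|) := mul_le_mul_of_nonneg_left hlim hM₂0
    rw [hsplit]
    calc _ ≤ |(∫ r in (0:ℝ)..P₁, F r) - ∫ r in (0:ℝ)..P₁, F' r|
            + |(∫ r in (0:ℝ)..P₁, F' r) - ∫ r in (0:ℝ)..P', F' r| := abs_add_le _ _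
      _ ≤ L₁ * R' * Real.exp (-a) * |s - s'| + M₂ * (Rρ * Real.exp (-a / 2) * |s - s'|) := add_le_add h1 h2
      _ = (L₁ * R' * Real.exp (-a) + M₂ * Rρ * Real.exp (-a / 2)) * |s - s'| := by ring
  -- (3) the viscosity inequality at touching times off `D'`, and (4) the OU decay from AE-2′
  have hvisc : OUViscosityIneqAt U s₁ C (fun s => s ∉ D') := by
    intro φ φₛ φ₁ φ₂ s₀ ρ₀ hs₀ hρ₀ hs₀D hφs hφ1 hφ2 hmax
    exact viscosity_inequality_window_at (w := fun t' r => clusterFlux (T t') r (𝒞 t' r)) hC hcont' hbd hℓp hℓm hnc hU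
      φ φₛ φ₁ φ₂ s₀ ρ₀ (hτ s₀ hs₀.le).1 hρ₀ (hlawL _ (hτ s₀ hs₀.le) hs₀D) hφs hφ1 hφ2 hmax
  have key := hOU U s₁ (K / 2) D' hD'c hD'0 hUcont hU0 hUgr (by positivity) hULip hvisc
  -- back to `(t, R)`
  have hnt : 0 < -t := by linarith
  have htmem : t ∈ Ioo t₀ 0 := ⟨lt_of_lt_of_le ht₁ ht₁t, ht⟩
  set s : ℝ := -Real.log (-t) with hs
  have hss₁ : s₁ ≤ s := by
    rw [hs, hs₁]
    have := Real.log_le_log hnt (by linarith : -t ≤ -t₁)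
    linarith
  have hτs : -Real.exp (-s) = t := by rw [hs, neg_neg, Real.exp_log hnt, neg_neg]
  have hsq : Real.exp (-s / 2) = Real.sqrt (-t) := by
    rw [hs, neg_neg, Real.sqrt_eq_rpow, Real.rpow_def_of_pos hnt]
    congr 1; ring
  have hsqpos : 0 < Real.sqrt (-t) := Real.sqrt_pos.2 hnt
  have hρR : R / Real.sqrt (-t) * Real.exp (-s / 2) = R := by
    rw [hsq]; field_simp
  have hfin := key s hss₁ (R / Real.sqrt (-t)) (div_nonneg hR.le hsqpos.le)
  rw [hU, hρR, hτs] at hfin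
  have hexp : Real.exp (-lam * (s - s₁)) = (t / t₁) ^ lam := by
    have hq : 0 < t / t₁ := div_pos_of_neg_of_neg ht (by linarith)
    rw [Real.rpow_def_of_pos hq, hs, hs₁]
    congr 1
    have : Real.log (t / t₁) = Real.log (-t) - Real.log (-t₁) := by
      rw [← Real.log_div hnt.ne' hnt₁.ne', neg_div_neg_eq]
    rw [this]; ring
  rw [hexp] at hfin
  refine ⟨(window_integrableOn_Ioc hcont' hbd htmem R).mono_set Ioo_subset_Ioc_self, ?_⟩
  rw [setIntegral_Ioo_eq_intervalIntegral _ hR.le]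
  calc ∫ r in (0:ℝ)..R, clusterFlux (T t) r (𝒞 t r)
      ≤ A * (K / 2) * (1 + R / Real.sqrt (-t)) ^ 3 * (t / t₁) ^ lam := hfin
    _ = A * (Real.pi / 2) * (N₀ : ℝ) * C₁ * (1 + R / Real.sqrt (-t)) ^ 3 * (t / t₁) ^ lam := by rw [hK]; ring

end Summit.NavierStokesRegularity.NavierStokesRegularity.Theorems.PoloidalLiouville.CellFlux

end
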